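import Literature.Probability.Process.NewtonPotential
import Mathlib.MeasureTheory.Measure.Lebesgue.Complex
import Mathlib.Analysis.Complex.RealDeriv
import Mathlib.Analysis.Complex.CauchyIntegral
import HarnessLib

/-!
# The Laplacian of the real part of a holomorphic function, and of its square

Support for the conformal invariance of planar Brownian motion (P. Lévy (1948); Lawler,
*Conformally Invariant Processes in the Plane* (2005), Thm. 2.2) through Dynkin's formula
(`BrownianVec`: the Laplacian there is `lap`, the trace of `fderiv (fderiv ·)` on
`ℝ² = Fin 2 → ℝ`). For `f` holomorphic on an open `D ⊆ ℂ` and `θ ∈ ℂ`, the real function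
`V_θ = Re(θ̄ · f)` (read on `ℝ²` through `toC : ℝ² → ℂ`) satisfies, at every point of `D`,

* `lap_rePart_eq_zero` — **`Δ V_θ = 0`** (`V_θ` is harmonic), and
* `lap_rePart_sq` — **`Δ (V_θ²) = 2 |θ|² |f'|²`**,

i.e. `½Δ(V_θ²) = |∇V_θ|² = |θ|²|f'|²`: for the planar Brownian motion `Z`, the bracket of the
martingale `Re(θ̄ f(Z))` is `|θ|² ∫ |f'(Z)|² ds`, independently of the direction of `θ` — the
isotropy behind Lévy's theorem. The second derivatives along the coordinate lines are the
real parts of `θ̄ f''(z)` and of `θ̄ f''(z) i²` (`Process.hess_apply_eq_of_line`).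

## References

* G. F. Lawler, *Conformally Invariant Processes in the Plane*, AMS (2005), §2.1 (proof of
  Thm. 2.2: "`u = Re f`, `v = Im f` are harmonic and `|∇u| = |∇v| = |f'|`, `∇u · ∇v = 0`").
* J.-F. Le Gall, *Brownian Motion, Martingales, and Stochastic Calculus* (2016), §7.4
  (planar Brownian motion and holomorphic functions).
-/

noncomputable section

open Filter Topology Set Complex
open scoped BigOperators ComplexConjugate

namespace Literature.Probability.Process

/-! ### `ℝ² ↔ ℂ` (Mathlib's `Complex.measurableEquivPi`) -/

/-- The point of `ℂ` with coordinates `v 0, v 1`: Mathlib's `Complex.measurableEquivPi.symm`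
(`= v 0 + v 1 · i`), wrapped in a name for the conformal files. [folklore] -/
@[irreducible] def toC (v : Fin 2 → ℝ) : ℂ := Complex.measurableEquivPi.symm v

/-- The coordinates of a complex number: Mathlib's `Complex.measurableEquivPi` (`= ![re, im]`).
[folklore] -/
@[irreducible] def ofC (z : ℂ) : Fin 2 → ℝ := Complex.measurableEquivPi z

/-- `toC v = v 0 + v 1 · i`. [folklore] -/
theorem toC_eq (v : Fin 2 → ℝ) : toC v = (v 0 : ℂ) + (v 1 : ℂ) * I := by
  unfold toC; exact Complex.measurableEquivPi_symm_apply v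

/-- `ofC z = ![re z, im z]`. [folklore] -/
theorem ofC_eq (z : ℂ) : ofC z = ![z.re, z.im] := by
  unfold ofC; exact Complex.measurableEquivPi_apply z

/-- Real part of `toC`. [folklore] -/
@[simp] theorem toC_re (v : Fin 2 → ℝ) : (toC v).re = v 0 := by rw [toC_eq]; simp

/-- Imaginary part of `toC`. [folklore] -/
@[simp] theorem toC_im (v : Fin 2 → ℝ) : (toC v).im = v 1 := by rw [toC_eq]; simp

/-- `toC ∘ ofC = id`. [folklore] -/
@[simp] theorem toC_ofC (z : ℂ) : toC (ofC z) = z := by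
  unfold toC ofC; exact Complex.measurableEquivPi.symm_apply_apply z

/-- `ofC ∘ toC = id`. [folklore] -/
@[simp] theorem ofC_toC (v : Fin 2 → ℝ) : ofC (toC v) = v := by
  unfold toC ofC; exact Complex.measurableEquivPi.apply_symm_apply v

/-- `ofC` at coordinate `0`. [folklore] -/
@[simp] theorem ofC_zero (z : ℂ) : ofC z 0 = z.re := by rw [ofC_eq]; simp

/-- `ofC` at coordinate `1`. [folklore] -/
@[simp] theorem ofC_one (z : ℂ) : ofC z 1 = z.im := by rw [ofC_eq]; simp

/-- `toC` is additive. [folklore] -/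
theorem toC_add (v w : Fin 2 → ℝ) : toC (v + w) = toC v + toC w := by
  apply Complex.ext <;> simp

/-- `toC` is continuous. [folklore] -/
@[fun_prop] theorem continuous_toC : Continuous toC := by
  have : toC = fun v : Fin 2 → ℝ ↦ (v 0 : ℂ) + (v 1 : ℂ) * I := funext toC_eq
  rw [this]; fun_prop

/-- `ofC` is continuous. [folklore] -/
@[fun_prop] theorem continuous_ofC : Continuous ofC := by
  have : ofC = fun z : ℂ ↦ ![z.re, z.im] := funext ofC_eq
  rw [this]
  refine continuous_pi fun i ↦ ?_
  fin_cases i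
  · exact Complex.continuous_re
  · exact Complex.continuous_im

/-- `toC` is smooth (it is real-linear). [folklore] -/
theorem contDiff_toC {n : WithTop ℕ∞} : ContDiff ℝ n toC := by
  have : toC = fun v : Fin 2 → ℝ ↦ (v 0 : ℂ) + (v 1 : ℂ) * I := funext toC_eq
  rw [this]
  exact ((Complex.ofRealCLM.contDiff.comp (contDiff_apply ℝ ℝ (0 : Fin 2))).add
    ((Complex.ofRealCLM.contDiff.comp (contDiff_apply ℝ ℝ (1 : Fin 2))).mul contDiff_const))

/-- `toC` is measurable. [folklore] -/
@[fun_prop] theorem measurable_toC : Measurable toC := by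
  unfold toC; exact Complex.measurableEquivPi.symm.measurable

/-- `ofC` is measurable. [folklore] -/
@[fun_prop] theorem measurable_ofC : Measurable ofC := by
  unfold ofC; exact Complex.measurableEquivPi.measurable

/-- Moving along the first coordinate line is adding a real number. [folklore] -/
theorem toC_add_smul_bvec_zero (v : Fin 2 → ℝ) (t : ℝ) : toC (v + t • bvec 0) = toC v + t := by
  apply Complex.ext <;> simp [bvec]

/-- Moving along the second coordinate line is adding an imaginary number. [folklore] -/
theorem toC_add_smul_bvec_one (v : Fin 2 → ℝ) (t : ℝ) : toC (v + t • bvec 1) = toC v + t * I := by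
  apply Complex.ext <;> simp [bvec]

/-! ### The potential `V_θ = Re(θ̄ f)` -/

variable {D : Set ℂ} {f : ℂ → ℂ}

/-- **`V_θ(v) = Re(θ̄ f(v))`**, the real-linear functional `θ̄·` of the holomorphic `f`, read on
`ℝ²` ([Lawler] §2.1: `u = Re f`, `v = Im f`; here all real combinations at once). [folklore] -/
def rePart (θ : ℂ) (f : ℂ → ℂ) (v : Fin 2 → ℝ) : ℝ := (conj θ * f (toC v)).re

/-- Unfolding `rePart`. [folklore] -/
theorem rePart_apply (θ : ℂ) (f : ℂ → ℂ) (v : Fin 2 → ℝ) :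
    rePart θ f v = (conj θ * f (toC v)).re := rfl

/-- A holomorphic function on an open set is real-`C^∞` there (through `toC`). [folklore] -/
theorem contDiffOn_comp_toC (hD : IsOpen D) (hf : DifferentiableOn ℂ f D) {n : WithTop ℕ∞} :
    ContDiffOn ℝ n (fun v ↦ f (toC v)) (toC ⁻¹' D) := by
  have h1 : ContDiffOn ℂ n f D := (hf.analyticOnNhd hD).contDiffOn_of_completeSpace
  exact (h1.restrict_scalars ℝ).comp contDiff_toC.contDiffOn (fun v hv ↦ hv)

/-- `V_θ` is `C^∞` on `toC⁻¹ D`. [folklore] -/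
theorem contDiffOn_rePart (hD : IsOpen D) (hf : DifferentiableOn ℂ f D) (θ : ℂ) {n : WithTop ℕ∞} :
    ContDiffOn ℝ n (rePart θ f) (toC ⁻¹' D) := by
  unfold rePart
  exact Complex.reCLM.contDiff.comp_contDiffOn (contDiffOn_const.mul (contDiffOn_comp_toC hD hf))

/-- `V_θ²` is `C^∞` on `toC⁻¹ D`. [folklore] -/
theorem contDiffOn_rePart_sq (hD : IsOpen D) (hf : DifferentiableOn ℂ f D) (θ : ℂ) {n : WithTop ℕ∞} :
    ContDiffOn ℝ n (fun v ↦ rePart θ f v ^ 2) (toC ⁻¹' D) :=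
  (contDiffOn_rePart hD hf θ).pow 2

/-- `toC⁻¹ D` is open. [folklore] -/
theorem isOpen_preimage_toC (hD : IsOpen D) : IsOpen (toC ⁻¹' D) := hD.preimage continuous_toC

/-- Derivative of the real part of a complex path. [folklore] -/
theorem hasDerivAt_re_of_hasDerivAt {F : ℝ → ℂ} {F' : ℂ} {t : ℝ} (h : HasDerivAt F F' t) :
    HasDerivAt (fun s ↦ (F s).re) F'.re t :=
  Complex.reCLM.hasFDerivAt.comp_hasDerivAt t h

/-- The derivative of a holomorphic function is holomorphic (open set). [folklore] -/
theorem differentiableOn_deriv (hD : IsOpen D) (hf : DifferentiableOn ℂ f D) :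
    DifferentiableOn ℂ (deriv f) D :=
  ((hf.analyticOnNhd hD).deriv).differentiableOn

/-- **Derivative along a horizontal line**: `s ↦ θ̄ f(z + s)` has derivative `θ̄ f'(z + t)` at
`t` when `z + t ∈ D`. [folklore] -/
theorem hasDerivAt_horizontal (hD : IsOpen D) (hf : DifferentiableOn ℂ f D) (θ z : ℂ) {t : ℝ}
    (ht : z + t ∈ D) :
    HasDerivAt (fun s : ℝ ↦ conj θ * f (z + s)) (conj θ * deriv f (z + t)) t := by
  have h1 : HasDerivAt f (deriv f (z + t)) (z + t) :=
    (hf.differentiableAt (hD.mem_nhds ht)).hasDerivAt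
  have h2 : HasDerivAt (fun w : ℂ ↦ f (z + w)) (deriv f (z + t)) (t : ℂ) :=
    HasDerivAt.comp_const_add z _ h1
  exact (h2.comp_ofReal).const_mul _

/-- **Derivative along a vertical line**: `s ↦ θ̄ f(z + s i)` has derivative `θ̄ f'(z + t i) i`
at `t` when `z + t i ∈ D`. [folklore] -/
theorem hasDerivAt_vertical (hD : IsOpen D) (hf : DifferentiableOn ℂ f D) (θ z : ℂ) {t : ℝ}
    (ht : z + t * I ∈ D) :
    HasDerivAt (fun s : ℝ ↦ conj θ * f (z + s * I)) (conj θ * (deriv f (z + t * I) * I)) t := by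
  have h1 : HasDerivAt f (deriv f (z + t * I)) (z + t * I) :=
    (hf.differentiableAt (hD.mem_nhds ht)).hasDerivAt
  have hl : HasDerivAt (fun w : ℂ ↦ z + w * I) I (t : ℂ) := by
    simpa using ((hasDerivAt_id (t : ℂ)).mul_const I).const_add z
  have h2 : HasDerivAt (fun w : ℂ ↦ f (z + w * I)) (deriv f (z + t * I) * I) (t : ℂ) :=
    h1.comp (t : ℂ) hl
  exact (h2.comp_ofReal).const_mul _

/-- Points of a line through a point of an open set stay in the set for small times. [folklore] -/
theorem eventually_add_mem (hD : IsOpen D) {z : ℂ} (hz : z ∈ D) (c : ℂ) :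
    ∀ᶠ t : ℝ in 𝓝 0, z + t * c ∈ D := by
  have hc : Continuous fun t : ℝ ↦ z + t * c := by fun_prop
  have : z + (0 : ℝ) * c ∈ D := by simpa using hz
  exact hc.continuousAt.preimage_mem_nhds (hD.mem_nhds this)

/-- **Second derivative of `V_θ` along the horizontal line**: `Re(θ̄ f''(z))`. [folklore] -/
theorem hess_rePart_zero (hD : IsOpen D) (hf : DifferentiableOn ℂ f D) (θ : ℂ) {v : Fin 2 → ℝ}
    (hv : toC v ∈ D) :
    hess (rePart θ f) v (bvec 0) (bvec 0) = (conj θ * deriv (deriv f) (toC v)).re := by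
  set z := toC v with hz
  refine hess_apply_eq_of_line (isOpen_preimage_toC hD) (contDiffOn_rePart hD hf θ) hv (bvec 0)
    (D₁ := fun t ↦ (conj θ * deriv f (z + t)).re) ?_ ?_
  · filter_upwards [eventually_add_mem hD hv 1] with t ht
    rw [mul_one] at ht
    have h := hasDerivAt_re_of_hasDerivAt (hasDerivAt_horizontal hD hf θ z ht)
    refine h.congr_of_eventuallyEq (Eventually.of_forall fun s ↦ ?_)
    simp only [rePart, toC_add_smul_bvec_zero, hz]
  · have h0 : z + ((0 : ℝ) : ℂ) ∈ D := by simpa using hv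
    have h := hasDerivAt_re_of_hasDerivAt
      (hasDerivAt_horizontal hD (differentiableOn_deriv hD hf) θ z h0)
    simpa using h

/-- **Second derivative of `V_θ` along the vertical line**: `−Re(θ̄ f''(z))`. [folklore] -/
theorem hess_rePart_one (hD : IsOpen D) (hf : DifferentiableOn ℂ f D) (θ : ℂ) {v : Fin 2 → ℝ}
    (hv : toC v ∈ D) :
    hess (rePart θ f) v (bvec 1) (bvec 1) = -(conj θ * deriv (deriv f) (toC v)).re := by
  set z := toC v with hz
  refine hess_apply_eq_of_line (isOpen_preimage_toC hD) (contDiffOn_rePart hD hf θ) hv (bvec 1)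
    (D₁ := fun t ↦ (conj θ * (deriv f (z + t * I) * I)).re) ?_ ?_
  · filter_upwards [eventually_add_mem hD hv I] with t ht
    have h := hasDerivAt_re_of_hasDerivAt (hasDerivAt_vertical hD hf θ z ht)
    refine h.congr_of_eventuallyEq (Eventually.of_forall fun s ↦ ?_)
    simp only [rePart, toC_add_smul_bvec_one, hz]
  · have h0 : z + ((0 : ℝ) : ℂ) * I ∈ D := by simpa using hv
    have h := hasDerivAt_re_of_hasDerivAt
      ((hasDerivAt_vertical hD (differentiableOn_deriv hD hf) θ z h0).mul_const I)
    have e : (conj θ * (deriv (deriv f) (z + ((0 : ℝ) : ℂ) * I) * I) * I).re =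
        -(conj θ * deriv (deriv f) z).re := by
      simp only [Complex.ofReal_zero, zero_mul, add_zero]
      rw [mul_assoc, mul_assoc, Complex.I_mul_I, mul_neg, mul_one, mul_neg, Complex.neg_re]
    rw [e] at h
    refine h.congr_of_eventuallyEq (Eventually.of_forall fun s ↦ ?_)
    simp only [mul_assoc]

/-- **`V_θ = Re(θ̄ f)` is harmonic**: `Δ V_θ = 0` on `D` (generalises, to all real directions
`θ`, the harmonicity of `u = Re f`, `v = Im f` used in [Lawler] §2.1, proof of Thm. 2.2).
[cite: Lawler2005ConformallyInvariant, §2.1 (proof of Thm. 2.2)] -/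
theorem lap_rePart_eq_zero (hD : IsOpen D) (hf : DifferentiableOn ℂ f D) (θ : ℂ) {v : Fin 2 → ℝ}
    (hv : toC v ∈ D) : lap (rePart θ f) v = 0 := by
  rw [lap, Fin.sum_univ_two, hess_rePart_zero hD hf θ hv, hess_rePart_one hD hf θ hv, add_neg_cancel]

/-! ### The square `V_θ²` -/

/-- `(Re(w i))² + (Re w)² = |w|²`-type identity: `(Re w)² + (Re (w i))² = ‖w‖²`. [folklore] -/
theorem re_sq_add_re_mul_I_sq (w : ℂ) : w.re ^ 2 + (w * I).re ^ 2 = ‖w‖ ^ 2 := by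
  rw [Complex.mul_I_re, Complex.sq_norm, Complex.normSq_apply]; ring

/-- **Second derivative of `V_θ²` along the horizontal line.** [folklore] -/
theorem hess_rePart_sq_zero (hD : IsOpen D) (hf : DifferentiableOn ℂ f D) (θ : ℂ) {v : Fin 2 → ℝ}
    (hv : toC v ∈ D) :
    hess (fun v ↦ rePart θ f v ^ 2) v (bvec 0) (bvec 0) =
      2 * ((conj θ * deriv f (toC v)).re ^ 2 +
        (conj θ * f (toC v)).re * (conj θ * deriv (deriv f) (toC v)).re) := by
  set z := toC v with hz
  -- first derivative along the line: `2 V V'`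
  set D₁ : ℝ → ℝ := fun t ↦ 2 * ((conj θ * f (z + t)).re * (conj θ * deriv f (z + t)).re) with hD₁
  refine hess_apply_eq_of_line (isOpen_preimage_toC hD) (contDiffOn_rePart_sq hD hf θ) hv (bvec 0)
    (D₁ := D₁) ?_ ?_
  · filter_upwards [eventually_add_mem hD hv 1] with t ht
    rw [mul_one] at ht
    have h := (hasDerivAt_re_of_hasDerivAt (hasDerivAt_horizontal hD hf θ z ht)).pow 2
    have e : ∀ s : ℝ, rePart θ f (v + s • bvec 0) ^ 2 = ((conj θ * f (z + s)).re) ^ 2 := fun s ↦ by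
      simp only [rePart, toC_add_smul_bvec_zero, hz]
    simp_rw [e]
    refine h.congr_deriv ?_
    simp only [hD₁, Nat.cast_ofNat]
    ring
  · have h0 : z + ((0 : ℝ) : ℂ) ∈ D := by simpa using hv
    have hV := hasDerivAt_re_of_hasDerivAt (hasDerivAt_horizontal hD hf θ z h0)
    have hV' := hasDerivAt_re_of_hasDerivAt
      (hasDerivAt_horizontal hD (differentiableOn_deriv hD hf) θ z h0)
    have h := (hV.mul hV').const_mul 2
    simp only [Complex.ofReal_zero, add_zero] at h
    refine h.congr_deriv ?_
    ring

/-- **Second derivative of `V_θ²` along the vertical line.** [folklore] -/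
theorem hess_rePart_sq_one (hD : IsOpen D) (hf : DifferentiableOn ℂ f D) (θ : ℂ) {v : Fin 2 → ℝ}
    (hv : toC v ∈ D) :
    hess (fun v ↦ rePart θ f v ^ 2) v (bvec 1) (bvec 1) =
      2 * ((conj θ * deriv f (toC v) * I).re ^ 2 -
        (conj θ * f (toC v)).re * (conj θ * deriv (deriv f) (toC v)).re) := by
  set z := toC v with hz
  set D₁ : ℝ → ℝ := fun t ↦
    2 * ((conj θ * f (z + t * I)).re * (conj θ * (deriv f (z + t * I) * I)).re) with hD₁
  refine hess_apply_eq_of_line (isOpen_preimage_toC hD) (contDiffOn_rePart_sq hD hf θ) hv (bvec 1)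
    (D₁ := D₁) ?_ ?_
  · filter_upwards [eventually_add_mem hD hv I] with t ht
    have h := (hasDerivAt_re_of_hasDerivAt (hasDerivAt_vertical hD hf θ z ht)).pow 2
    have e : ∀ s : ℝ, rePart θ f (v + s • bvec 1) ^ 2 = ((conj θ * f (z + s * I)).re) ^ 2 := fun s ↦ by
      simp only [rePart, toC_add_smul_bvec_one, hz]
    simp_rw [e]
    refine h.congr_deriv ?_
    simp only [hD₁, Nat.cast_ofNat]
    ring
  · have h0 : z + ((0 : ℝ) : ℂ) * I ∈ D := by simpa using hv
    have hV := hasDerivAt_re_of_hasDerivAt (hasDerivAt_vertical hD hf θ z h0)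
    have hV' := hasDerivAt_re_of_hasDerivAt
      ((hasDerivAt_vertical hD (differentiableOn_deriv hD hf) θ z h0).mul_const I)
    have h := (hV.mul hV').const_mul 2
    simp only [Complex.ofReal_zero, zero_mul, add_zero] at h
    have e2 : (conj θ * (deriv (deriv f) z * I) * I).re = -(conj θ * deriv (deriv f) z).re := by
      rw [mul_assoc, mul_assoc, Complex.I_mul_I, mul_neg, mul_one, mul_neg, Complex.neg_re]
    rw [e2] at h
    refine (h.congr_of_eventuallyEq (Eventually.of_forall fun s ↦ ?_)).congr_deriv ?_
    · simp only [hD₁, Pi.mul_apply, mul_assoc]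
    · rw [mul_assoc (conj θ) (deriv f z) I]
      ring

/-- **`Δ (V_θ²) = 2 |θ|² |f'|²`** on `D` (so `½Δ(V_θ²) = |∇ V_θ|² = |θ|²|f'|²`: the bracket of
`Re(θ̄ f(Z))` grows at rate `|θ|²|f'(Z)|²`, the same clock for every direction `θ/|θ|`;
generalises [Lawler] §2.1's `|∇u| = |∇v| = |f'|` to all real directions).
[cite: Lawler2005ConformallyInvariant, §2.1 (proof of Thm. 2.2)] -/
theorem lap_rePart_sq (hD : IsOpen D) (hf : DifferentiableOn ℂ f D) (θ : ℂ) {v : Fin 2 → ℝ}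
    (hv : toC v ∈ D) :
    lap (fun v ↦ rePart θ f v ^ 2) v = 2 * (‖θ‖ ^ 2 * ‖deriv f (toC v)‖ ^ 2) := by
  rw [lap, Fin.sum_univ_two, hess_rePart_sq_zero hD hf θ hv, hess_rePart_sq_one hD hf θ hv]
  have key := re_sq_add_re_mul_I_sq (conj θ * deriv f (toC v))
  rw [norm_mul, Complex.norm_conj, mul_pow] at key
  linarith [key]

end Literature.Probability.Process

end
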